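import Summits.Ventures.Crystal3D.Theorems.StickyWulffConstantGenericWallFloorBarlowWindowExit
import Summits.Ventures.Crystal3D.Theorems.StickyWulffConstantGenericWallFloorBarlowOrbitFree
import Summits.Ventures.Crystal3D.Theorems.StickyWulffConstantGenericWallFloorStackWalkInjectiveTiltRef
import HarnessLib

/-!
# Window families with a vertical tilted from a REFERENCE vertical `e`: exit and end-injectivity over an `e`-window (K1b / EDGE-ON option (ε),
# bricks 1–2 in reference form, for the TOP families `e = −e₃`) (lane T crux `TextureLiminfV5`, stmt-Ventures-23912, sub-crux EDGE-ON `stub_edgeOn`)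

HONEST FRAMING. Venture `Summits/Ventures/Crystal3D` (cell `crystal3d-full`), route `route-Ventures-StickyWulffConstant`, helper `--supports` the
law-v5 crux `TextureLiminfV5` (stmt-Ventures-23912), registered line `TexShadow` v8.3, open stub `stub_edgeOn` (K4).  Rung credit only; F-C1 not moved; NOT
the stub.  Pure walk bookkeeping, standard axioms; E1 BY NAME (`hs₁/hcert`).

`…BarlowWindowExitTilt` / `…BarlowWindowFamilyTilt` (p696713 / p697132) are the `e₃`-window forms (plate-1 families).  The plate-2 (TOP) families walk toward `−e₃`
with their window in `−e₃`-heights; this file states the same three results for an ARBITRARY reference vertical `e` with ‖z − e‖ ≤ 1/4 (toolkit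
`…StackWalkInjectiveTiltRef`: `walkRun_refHeight_mono`), heights `⟪L p + s₀, e⟫`:
* `walkRun_refHeight_mono'` — reference heights never decrease along any number of further steps;
* **`windowStart_end_refHeight_gt`**, **`canon_orbitFree_tiltRef`**, **`canon_walkRun_injOn_tiltRef`**, **`windowFamily_walkRun_injOn_tiltRef`** — verbatim the
  `e₃` versions with `e` for `e₃`.
WHAT THIS IS NOT: not the top family itself (next brick); F-C1 not moved.
-/

noncomputable section

namespace Summit.Ventures.Crystal3D.Theorems

open Finset
open Literature.MathematicalPhysics.StatisticalMechanics
open scoped InnerProductSpace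

variable {X : Finset (EuclideanSpace ℝ (Fin 3))}

/-- Reference heights never decrease along a run with a tilted vertical (any number of further steps). -/
theorem walkRun_refHeight_mono' (hX : ∀ p ∈ X, ∀ q ∈ X, p ≠ q → 1 ≤ dist p q)
    {s₀ : EuclideanSpace ℝ (Fin 3)} (hs₀ : s₀ ∈ fccSlots) (hcert : ExactOnly 0 (fccSlots.filter fun w => 0 < ⟪w, s₀⟫_ℝ))
    {z e : EuclideanSpace ℝ (Fin 3)} (hz : ‖z‖ = 1) (hze : ‖z - e‖ ≤ 1 / 4)
    {s : EuclideanSpace ℝ (Fin 3) × List WalkEntry} (hI : WalkInv X z s) (k j : ℕ) :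
    ⟪(walkRun X z k s).1, e⟫_ℝ ≤ ⟪(walkRun X z (k + j) s).1, e⟫_ℝ := by
  induction j with
  | zero => simp
  | succ j IH => exact IH.trans (by rw [← add_assoc]; exact walkRun_refHeight_mono hX hs₀ hcert hz hze hI (k + j))

section Moved

variable (σ : ℤ → ℤ) (L : EuclideanSpace ℝ (Fin 3) ≃ₗᵢ[ℝ] EuclideanSpace ℝ (Fin 3)) (s₀ z v₀ : EuclideanSpace ℝ (Fin 3))
  (canon : ℤ → EuclideanSpace ℝ (Fin 3) → EuclideanSpace ℝ (Fin 3) × List WalkEntry) (ms : ℤ → EuclideanSpace ℝ (Fin 3))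

open scoped Classical in
/-- **A window-family walker with a tilted vertical ends above the reference-height window.** -/
theorem windowStart_end_refHeight_gt (hσ : IsHaggSeq σ) (hX₁ : ∀ p ∈ X, ∀ q ∈ X, p ≠ q → 1 ≤ dist p q)
    {s₁ : EuclideanSpace ℝ (Fin 3)} (hs₁ : s₁ ∈ fccSlots) (hcert : ExactOnly 0 (fccSlots.filter fun w => 0 < ⟪w, s₁⟫_ℝ))
    {e : EuclideanSpace ℝ (Fin 3)} (hz : ‖z‖ = 1) (hze : ‖z - e‖ ≤ 1 / 4)
    (hv₀ : v₀ ∈ fccSlots) (hv₀2 : v₀ 2 = Real.sqrt (2 / 3))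
    (hcanon₁ : ∀ m t, σ (m - 1) = 1 → canon m t = (t, [⟨L, v₀, 0⟩]))
    (hcanon₂ : ∀ m t, σ (m - 1) = -1 → canon m t =
      (t, [⟨twinFrame L (L (EuclideanSpace.single (2 : Fin 3) (1 : ℝ))),
            bestCapper (twinFrame L (L (EuclideanSpace.single (2 : Fin 3) (1 : ℝ)))) (L (EuclideanSpace.single (2 : Fin 3) (1 : ℝ))) z,
            L (EuclideanSpace.single (2 : Fin 3) (1 : ℝ))⟩, ⟨L, v₀, 0⟩]))
    (hms₁ : ∀ m, σ m = 1 → ms m = v₀)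
    (hms₂ : ∀ m, σ m = -1 → ms m =
      basalMirror (bestCapper (twinFrame L (L (EuclideanSpace.single (2 : Fin 3) (1 : ℝ)))) (L (EuclideanSpace.single (2 : Fin 3) (1 : ℝ))) z))
    {δ : ℝ} (hδ0 : 0 < δ) (hδ : ∀ m, δ ≤ ⟪L (ms m), e⟫_ℝ)
    (R : Set (EuclideanSpace ℝ (Fin 3)))
    (hR : ∀ m i j : ℤ, barlowPos 1 (Real.sqrt (2 / 3)) σ m i j ∈ R →
      ∀ q ∈ barlowStacking 1 (Real.sqrt (2 / 3)) σ, dist q (barlowPos 1 (Real.sqrt (2 / 3)) σ m i j) ≤ 1 → L q + s₀ ∈ X)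
    (H Ztop : ℝ) (hHZ : H + 1 ≤ Ztop) (m a b : ℤ)
    (hRin : ∀ m' a' b' : ℤ,
      H ≤ ⟪L (barlowPos 1 (Real.sqrt (2 / 3)) σ m' a' b') + s₀, e⟫_ℝ →
      ⟪L (barlowPos 1 (Real.sqrt (2 / 3)) σ m' a' b') + s₀, e⟫_ℝ ≤ Ztop →
      ‖barlowPos 1 (Real.sqrt (2 / 3)) σ m' a' b' - barlowPos 1 (Real.sqrt (2 / 3)) σ m a b‖ ≤ (Ztop - H) / δ + 1 →
      barlowPos 1 (Real.sqrt (2 / 3)) σ m' a' b' ∈ R)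
    (hlow : H ≤ ⟪L (barlowPos 1 (Real.sqrt (2 / 3)) σ m a b) + s₀, e⟫_ℝ)
    (hvalid : WalkInv X z (canon m (L (barlowPos 1 (Real.sqrt (2 / 3)) σ m a b) + s₀)) ∧
      StackWF z (canon m (L (barlowPos 1 (Real.sqrt (2 / 3)) σ m a b) + s₀)).2)
    {N : ℕ} (hN : ⌈(Ztop - H) / δ⌉₊ + 1 ≤ N) :
    Ztop < ⟪(walkRun X z N (canon m (L (barlowPos 1 (Real.sqrt (2 / 3)) σ m a b) + s₀))).1, e⟫_ℝ := by
  set p₀ := barlowPos 1 (Real.sqrt (2 / 3)) σ m a b with hp₀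
  set site : ℕ → EuclideanSpace ℝ (Fin 3) := fun k => p₀ + ∑ k' ∈ Finset.range k, ms (m + k') with hsite
  set ht : EuclideanSpace ℝ (Fin 3) → ℝ := fun p => ⟪L p + s₀, e⟫_ℝ with hht
  have hpos : ∀ m' t, (canon m' t).1 = t := by
    intro m' t
    rcases hσ (m' - 1) with h | h
    · rw [hcanon₁ m' t h]
    · rw [hcanon₂ m' t h]
  have hms : ∀ m', ‖ms m'‖ = 1 := by
    intro m'
    rcases hσ m' with h | h
    · rw [hms₁ m' h, norm_eq_one_of_mem_fccSlots hv₀]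
    · rw [hms₂ m' h, LinearIsometryEquiv.norm_map, norm_eq_one_of_mem_fccSlots (bestCapper_nabla_slot L z).1]
  have hgrow : ∀ k : ℕ, ht p₀ + k * δ ≤ ht (site k) := fun k => by
    simp only [hht, hsite]; exact height_site_ge L s₀ e ms hδ p₀ m k
  set K₀ : ℕ := ⌈(Ztop - H) / δ⌉₊ + 1 with hK₀
  have hK₀gt : (Ztop - H) / δ < ((K₀ : ℕ) : ℝ) := by
    rw [hK₀]; push_cast; have := Nat.le_ceil ((Ztop - H) / δ); linarith
  have habove : Ztop < ht (site K₀) := by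
    refine lt_of_lt_of_le ?_ (hgrow K₀)
    have h2 : Ztop - H < (K₀ : ℝ) * δ := by rw [div_lt_iff₀ hδ0] at hK₀gt; linarith
    show Ztop < ht p₀ + K₀ * δ
    have h1 : H ≤ ht p₀ := hlow
    linarith
  have hex : ∃ k : ℕ, Ztop < ht (site k) := ⟨K₀, habove⟩
  set n : ℕ := Nat.find hex with hn
  have hn_spec : Ztop < ht (site n) := Nat.find_spec hex
  have hn_min : ∀ k < n, ht (site k) ≤ Ztop := fun k hk => by
    have := Nat.find_min hex hk; push Not at this; exact this
  have hn_le : n ≤ K₀ := Nat.find_le habove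
  have hin : ∀ k < n, site k ∈ R := by
    intro k hk
    obtain ⟨a', b', hab⟩ := site_mem_barlowLayer σ L z v₀ ms hσ hv₀ hv₀2 hms₁ hms₂ m a b k
    have hab' : site k = barlowPos 1 (Real.sqrt (2 / 3)) σ (m + k) a' b' := hab
    have f1 : H ≤ ht (site k) := by
      have h1 := hgrow k; have h3 : (0 : ℝ) ≤ k * δ := by positivity
      have h2 : H ≤ ht p₀ := hlow
      linarith
    have f2 : ht (site k) ≤ Ztop := hn_min k hk
    have f3 : ‖site k - p₀‖ ≤ (Ztop - H) / δ + 1 := by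
      have hd : site k - p₀ = ∑ k' ∈ Finset.range k, ms (m + k') := by simp only [hsite]; abel
      rw [hd]
      calc ‖∑ k' ∈ Finset.range k, ms (m + k')‖ ≤ ∑ k' ∈ Finset.range k, ‖ms (m + k')‖ := norm_sum_le _ _
        _ = k := by simp [hms]
        _ ≤ (Ztop - H) / δ + 1 := by
            have hk' : (k : ℝ) + 1 ≤ (n : ℕ) := by exact_mod_cast hk
            have hni : ((n : ℕ) : ℝ) ≤ K₀ := by exact_mod_cast hn_le
            have hK₀le : ((K₀ : ℕ) : ℝ) ≤ (Ztop - H) / δ + 2 := by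
              rw [hK₀]; push_cast
              have := Nat.ceil_lt_add_one (div_nonneg (by linarith : (0 : ℝ) ≤ Ztop - H) hδ0.le); linarith
            linarith
    rw [hab'] at f1 f2 f3 ⊢
    exact hRin (m + k) a' b' f1 f2 f3
  obtain ⟨hrun, -⟩ := walkRun_canon_prefix σ L s₀ z v₀ canon ms hσ hX₁ hv₀ hv₀2 hcanon₁ hcanon₂ hms₁ hms₂ R hR n m a b hin
  have hnN : n ≤ N := hn_le.trans hN
  obtain ⟨d, rfl⟩ := Nat.exists_eq_add_of_le hnN
  rw [walkRun_add', hrun]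
  have hvalN := walkRun_valid hX₁ hs₁ hcert hz n hvalid.1 hvalid.2
  rw [hrun] at hvalN
  have hge := walkRun_refHeight_mono' hX₁ hs₁ hcert hz hze hvalN.1 0 d
  rw [zero_add, walkRun_zero] at hge
  rw [hpos] at hge
  have h1 : Ztop < ⟪L (site n) + s₀, e⟫_ℝ := hn_spec
  exact lt_of_lt_of_le h1 hge

/-- **Orbit-freeness, tilted vertical, exit sites above all starts in reference height.** -/
theorem canon_orbitFree_tiltRef (hσ : IsHaggSeq σ) (hX₁ : ∀ p ∈ X, ∀ q ∈ X, p ≠ q → 1 ≤ dist p q)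
    {s₁ : EuclideanSpace ℝ (Fin 3)} (hs₁ : s₁ ∈ fccSlots) (hcert : ExactOnly 0 (fccSlots.filter fun w => 0 < ⟪w, s₁⟫_ℝ))
    {e : EuclideanSpace ℝ (Fin 3)} (hz : ‖z‖ = 1) (hze : ‖z - e‖ ≤ 1 / 4)
    (hv₀ : v₀ ∈ fccSlots) (hv₀2 : v₀ 2 = Real.sqrt (2 / 3))
    (hcanon₁ : ∀ m t, σ (m - 1) = 1 → canon m t = (t, [⟨L, v₀, 0⟩]))
    (hcanon₂ : ∀ m t, σ (m - 1) = -1 → canon m t =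
      (t, [⟨twinFrame L (L (EuclideanSpace.single (2 : Fin 3) (1 : ℝ))),
            bestCapper (twinFrame L (L (EuclideanSpace.single (2 : Fin 3) (1 : ℝ)))) (L (EuclideanSpace.single (2 : Fin 3) (1 : ℝ))) z,
            L (EuclideanSpace.single (2 : Fin 3) (1 : ℝ))⟩, ⟨L, v₀, 0⟩]))
    (hms₁ : ∀ m, σ m = 1 → ms m = v₀)
    (hms₂ : ∀ m, σ m = -1 → ms m =
      basalMirror (bestCapper (twinFrame L (L (EuclideanSpace.single (2 : Fin 3) (1 : ℝ)))) (L (EuclideanSpace.single (2 : Fin 3) (1 : ℝ))) z))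
    (R : Set (EuclideanSpace ℝ (Fin 3)))
    (hR : ∀ m i j : ℤ, barlowPos 1 (Real.sqrt (2 / 3)) σ m i j ∈ R →
      ∀ q ∈ barlowStacking 1 (Real.sqrt (2 / 3)) σ, dist q (barlowPos 1 (Real.sqrt (2 / 3)) σ m i j) ≤ 1 → L q + s₀ ∈ X)
    {ι : Type*} (T : Finset ι) (mi ai bi : ι → ℤ) (n : ι → ℕ)
    (hin : ∀ i ∈ T, ∀ k < n i,
      barlowPos 1 (Real.sqrt (2 / 3)) σ (mi i) (ai i) (bi i) + ∑ k' ∈ Finset.range k, ms (mi i + k') ∈ R)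
    (hvalid : ∀ i ∈ T, WalkInv X z (canon (mi i) (L (barlowPos 1 (Real.sqrt (2 / 3)) σ (mi i) (ai i) (bi i)) + s₀)) ∧
      StackWF z (canon (mi i) (L (barlowPos 1 (Real.sqrt (2 / 3)) σ (mi i) (ai i) (bi i)) + s₀)).2)
    (hlines : ∀ i ∈ T, ∀ j ∈ T, i ≠ j → ∀ k ≤ n i,
      barlowPos 1 (Real.sqrt (2 / 3)) σ (mi i) (ai i) (bi i) + ∑ k' ∈ Finset.range k, ms (mi i + k') ≠
        barlowPos 1 (Real.sqrt (2 / 3)) σ (mi j) (ai j) (bi j))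
    (hexit : ∀ i ∈ T, ∀ j ∈ T,
      ⟪L (barlowPos 1 (Real.sqrt (2 / 3)) σ (mi j) (ai j) (bi j)) + s₀, e⟫_ℝ <
        ⟪L (barlowPos 1 (Real.sqrt (2 / 3)) σ (mi i) (ai i) (bi i) + ∑ k' ∈ Finset.range (n i), ms (mi i + k')) + s₀, e⟫_ℝ) :
    ∀ i ∈ T, ∀ j ∈ T, i ≠ j → ∀ k,
      walkRun X z k (canon (mi i) (L (barlowPos 1 (Real.sqrt (2 / 3)) σ (mi i) (ai i) (bi i)) + s₀)) ≠
        canon (mi j) (L (barlowPos 1 (Real.sqrt (2 / 3)) σ (mi j) (ai j) (bi j)) + s₀) := by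
  intro i hi j hj hij k hk
  have hpos : ∀ m t, (canon m t).1 = t := by
    intro m t
    rcases hσ (m - 1) with h | h
    · rw [hcanon₁ m t h]
    · rw [hcanon₂ m t h]
  have hpref := fun k' (hk' : k' ≤ n i) =>
    walkRun_canon_prefix σ L s₀ z v₀ canon ms hσ hX₁ hv₀ hv₀2 hcanon₁ hcanon₂ hms₁ hms₂ R hR k' (mi i) (ai i) (bi i)
      (fun k'' hk'' => hin i hi k'' (lt_of_lt_of_le hk'' hk'))
  by_cases hkn : k ≤ n i
  · obtain ⟨h1, -⟩ := hpref k hkn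
    rw [h1] at hk
    have hp := congrArg Prod.fst hk
    rw [hpos, hpos] at hp
    have hp' := L.injective (add_right_cancel hp)
    exact hlines i hi j hj hij k hkn hp'
  · push Not at hkn
    obtain ⟨d, hd⟩ := Nat.exists_eq_add_of_lt hkn
    obtain ⟨h1, -⟩ := hpref (n i) le_rfl
    have hrun : walkRun X z k (canon (mi i) (L (barlowPos 1 (Real.sqrt (2 / 3)) σ (mi i) (ai i) (bi i)) + s₀)) =
        walkRun X z (0 + (d + 1)) (canon (mi i + (n i : ℕ))
          (L (barlowPos 1 (Real.sqrt (2 / 3)) σ (mi i) (ai i) (bi i) + ∑ k' ∈ Finset.range (n i), ms (mi i + k')) + s₀)) := by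
      rw [zero_add, hd, add_assoc, walkRun_add', h1]
    have hvalN := walkRun_valid hX₁ hs₁ hcert hz (n i) (hvalid i hi).1 (hvalid i hi).2
    rw [h1] at hvalN
    have hge := walkRun_refHeight_mono' hX₁ hs₁ hcert hz hze hvalN.1 0 (d + 1)
    rw [walkRun_zero, ← hrun, hk, hpos, hpos] at hge
    have hlt := hexit i hi j hj
    linarith

/-- **End-injectivity of the family with a tilted vertical, reference-height exit condition.** -/
theorem canon_walkRun_injOn_tiltRef (hσ : IsHaggSeq σ) (hX₁ : ∀ p ∈ X, ∀ q ∈ X, p ≠ q → 1 ≤ dist p q)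
    {s₁ : EuclideanSpace ℝ (Fin 3)} (hs₁ : s₁ ∈ fccSlots) (hcert : ExactOnly 0 (fccSlots.filter fun w => 0 < ⟪w, s₁⟫_ℝ))
    {e : EuclideanSpace ℝ (Fin 3)} (hz : ‖z‖ = 1) (hze : ‖z - e‖ ≤ 1 / 4)
    (hv₀ : v₀ ∈ fccSlots) (hv₀2 : v₀ 2 = Real.sqrt (2 / 3))
    (hcanon₁ : ∀ m t, σ (m - 1) = 1 → canon m t = (t, [⟨L, v₀, 0⟩]))
    (hcanon₂ : ∀ m t, σ (m - 1) = -1 → canon m t =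
      (t, [⟨twinFrame L (L (EuclideanSpace.single (2 : Fin 3) (1 : ℝ))),
            bestCapper (twinFrame L (L (EuclideanSpace.single (2 : Fin 3) (1 : ℝ)))) (L (EuclideanSpace.single (2 : Fin 3) (1 : ℝ))) z,
            L (EuclideanSpace.single (2 : Fin 3) (1 : ℝ))⟩, ⟨L, v₀, 0⟩]))
    (hms₁ : ∀ m, σ m = 1 → ms m = v₀)
    (hms₂ : ∀ m, σ m = -1 → ms m =
      basalMirror (bestCapper (twinFrame L (L (EuclideanSpace.single (2 : Fin 3) (1 : ℝ)))) (L (EuclideanSpace.single (2 : Fin 3) (1 : ℝ))) z))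
    (R : Set (EuclideanSpace ℝ (Fin 3)))
    (hR : ∀ m i j : ℤ, barlowPos 1 (Real.sqrt (2 / 3)) σ m i j ∈ R →
      ∀ q ∈ barlowStacking 1 (Real.sqrt (2 / 3)) σ, dist q (barlowPos 1 (Real.sqrt (2 / 3)) σ m i j) ≤ 1 → L q + s₀ ∈ X)
    {ι : Type*} (T : Finset ι) (mi ai bi : ι → ℤ) (n : ι → ℕ)
    (hin : ∀ i ∈ T, ∀ k < n i,
      barlowPos 1 (Real.sqrt (2 / 3)) σ (mi i) (ai i) (bi i) + ∑ k' ∈ Finset.range k, ms (mi i + k') ∈ R)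
    (hvalid : ∀ i ∈ T, WalkInv X z (canon (mi i) (L (barlowPos 1 (Real.sqrt (2 / 3)) σ (mi i) (ai i) (bi i)) + s₀)) ∧
      StackWF z (canon (mi i) (L (barlowPos 1 (Real.sqrt (2 / 3)) σ (mi i) (ai i) (bi i)) + s₀)).2)
    (hlines : ∀ i ∈ T, ∀ j ∈ T, i ≠ j → ∀ k ≤ n i,
      barlowPos 1 (Real.sqrt (2 / 3)) σ (mi i) (ai i) (bi i) + ∑ k' ∈ Finset.range k, ms (mi i + k') ≠
        barlowPos 1 (Real.sqrt (2 / 3)) σ (mi j) (ai j) (bi j))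
    (hexit : ∀ i ∈ T, ∀ j ∈ T,
      ⟪L (barlowPos 1 (Real.sqrt (2 / 3)) σ (mi j) (ai j) (bi j)) + s₀, e⟫_ℝ <
        ⟪L (barlowPos 1 (Real.sqrt (2 / 3)) σ (mi i) (ai i) (bi i) + ∑ k' ∈ Finset.range (n i), ms (mi i + k')) + s₀, e⟫_ℝ)
    (N : ℕ) :
    ∀ i ∈ T, ∀ j ∈ T,
      walkRun X z N (canon (mi i) (L (barlowPos 1 (Real.sqrt (2 / 3)) σ (mi i) (ai i) (bi i)) + s₀)) =
        walkRun X z N (canon (mi j) (L (barlowPos 1 (Real.sqrt (2 / 3)) σ (mi j) (ai j) (bi j)) + s₀)) → i = j :=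
  walkRun_injOn_of_orbitFree hX₁ hs₁ hcert hz T
    (fun i => canon (mi i) (L (barlowPos 1 (Real.sqrt (2 / 3)) σ (mi i) (ai i) (bi i)) + s₀)) hvalid
    (canon_orbitFree_tiltRef σ L s₀ z v₀ canon ms hσ hX₁ hs₁ hcert hz hze hv₀ hv₀2 hcanon₁ hcanon₂ hms₁ hms₂ R hR T mi ai bi n hin hvalid
      hlines hexit) N

open scoped Classical in
/-- **Window families with a tilted vertical are end-injective over a reference-height window.** -/
theorem windowFamily_walkRun_injOn_tiltRef (hσ : IsHaggSeq σ) (hX₁ : ∀ p ∈ X, ∀ q ∈ X, p ≠ q → 1 ≤ dist p q)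
    {s₁ : EuclideanSpace ℝ (Fin 3)} (hs₁ : s₁ ∈ fccSlots) (hcert : ExactOnly 0 (fccSlots.filter fun w => 0 < ⟪w, s₁⟫_ℝ))
    {e : EuclideanSpace ℝ (Fin 3)} (he : ‖e‖ = 1) (hz : ‖z‖ = 1) (hze : ‖z - e‖ ≤ 1 / 4)
    (hv₀ : v₀ ∈ fccSlots) (hv₀2 : v₀ 2 = Real.sqrt (2 / 3))
    (hcanon₁ : ∀ m t, σ (m - 1) = 1 → canon m t = (t, [⟨L, v₀, 0⟩]))
    (hcanon₂ : ∀ m t, σ (m - 1) = -1 → canon m t =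
      (t, [⟨twinFrame L (L (EuclideanSpace.single (2 : Fin 3) (1 : ℝ))),
            bestCapper (twinFrame L (L (EuclideanSpace.single (2 : Fin 3) (1 : ℝ)))) (L (EuclideanSpace.single (2 : Fin 3) (1 : ℝ))) z,
            L (EuclideanSpace.single (2 : Fin 3) (1 : ℝ))⟩, ⟨L, v₀, 0⟩]))
    (hms₁ : ∀ m, σ m = 1 → ms m = v₀)
    (hms₂ : ∀ m, σ m = -1 → ms m =
      basalMirror (bestCapper (twinFrame L (L (EuclideanSpace.single (2 : Fin 3) (1 : ℝ)))) (L (EuclideanSpace.single (2 : Fin 3) (1 : ℝ))) z))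
    {δ : ℝ} (hδ0 : 0 < δ) (hδ : ∀ m, δ ≤ ⟪L (ms m), e⟫_ℝ)
    (R : Set (EuclideanSpace ℝ (Fin 3)))
    (hR : ∀ m i j : ℤ, barlowPos 1 (Real.sqrt (2 / 3)) σ m i j ∈ R →
      ∀ q ∈ barlowStacking 1 (Real.sqrt (2 / 3)) σ, dist q (barlowPos 1 (Real.sqrt (2 / 3)) σ m i j) ≤ 1 → L q + s₀ ∈ X)
    (H Ztop : ℝ) (hHZ : H + 1 ≤ Ztop)
    {ι : Type*} (T : Finset ι) (mi ai bi : ι → ℤ)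
    (hRin : ∀ i ∈ T, ∀ m a b : ℤ,
      H ≤ ⟪L (barlowPos 1 (Real.sqrt (2 / 3)) σ m a b) + s₀, e⟫_ℝ →
      ⟪L (barlowPos 1 (Real.sqrt (2 / 3)) σ m a b) + s₀, e⟫_ℝ ≤ Ztop →
      ‖barlowPos 1 (Real.sqrt (2 / 3)) σ m a b - barlowPos 1 (Real.sqrt (2 / 3)) σ (mi i) (ai i) (bi i)‖ ≤ (Ztop - H) / δ + 1 →
      barlowPos 1 (Real.sqrt (2 / 3)) σ m a b ∈ R)
    (hlow : ∀ i ∈ T, H ≤ ⟪L (barlowPos 1 (Real.sqrt (2 / 3)) σ (mi i) (ai i) (bi i)) + s₀, e⟫_ℝ)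
    (hpred : ∀ i ∈ T, ⟪L (barlowPos 1 (Real.sqrt (2 / 3)) σ (mi i) (ai i) (bi i) - ms (mi i - 1)) + s₀, e⟫_ℝ < H)
    (hinjT : ∀ i ∈ T, ∀ j ∈ T,
      barlowPos 1 (Real.sqrt (2 / 3)) σ (mi i) (ai i) (bi i) = barlowPos 1 (Real.sqrt (2 / 3)) σ (mi j) (ai j) (bi j) → i = j)
    (hvalid : ∀ i ∈ T, WalkInv X z (canon (mi i) (L (barlowPos 1 (Real.sqrt (2 / 3)) σ (mi i) (ai i) (bi i)) + s₀)) ∧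
      StackWF z (canon (mi i) (L (barlowPos 1 (Real.sqrt (2 / 3)) σ (mi i) (ai i) (bi i)) + s₀)).2)
    (N : ℕ) :
    ∀ i ∈ T, ∀ j ∈ T,
      walkRun X z N (canon (mi i) (L (barlowPos 1 (Real.sqrt (2 / 3)) σ (mi i) (ai i) (bi i)) + s₀)) =
        walkRun X z N (canon (mi j) (L (barlowPos 1 (Real.sqrt (2 / 3)) σ (mi j) (ai j) (bi j)) + s₀)) → i = j := by
  set bp : ℤ → ℤ → ℤ → EuclideanSpace ℝ (Fin 3) := fun m a b => barlowPos 1 (Real.sqrt (2 / 3)) σ m a b with hbp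
  set site : ι → ℕ → EuclideanSpace ℝ (Fin 3) :=
    fun i k => bp (mi i) (ai i) (bi i) + ∑ k' ∈ Finset.range k, ms (mi i + k') with hsite
  set ht : EuclideanSpace ℝ (Fin 3) → ℝ := fun p => ⟪L p + s₀, e⟫_ℝ with hht
  have hms : ∀ m, ‖ms m‖ = 1 := by
    intro m
    rcases hσ m with h | h
    · rw [hms₁ m h, norm_eq_one_of_mem_fccSlots hv₀]
    · rw [hms₂ m h, LinearIsometryEquiv.norm_map, norm_eq_one_of_mem_fccSlots (bestCapper_nabla_slot L z).1]
  have hgrow : ∀ i (k : ℕ), ht (bp (mi i) (ai i) (bi i)) + k * δ ≤ ht (site i k) := fun i k => by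
    simp only [hht, hsite]; exact height_site_ge L s₀ e ms hδ _ (mi i) k
  have hsucc : ∀ i (k : ℕ), site i (k + 1) = site i k + ms (mi i + k) := fun i k => by
    simp only [hsite]; rw [Finset.sum_range_succ, add_assoc]
  set K₀ : ℕ := ⌈(Ztop - H) / δ⌉₊ + 1 with hK₀
  have hZH : 0 ≤ (Ztop - H) / δ := div_nonneg (by linarith) hδ0.le
  have hK₀gt : (Ztop - H) / δ < ((K₀ : ℕ) : ℝ) := by
    rw [hK₀]; push_cast; have := Nat.le_ceil ((Ztop - H) / δ); linarith
  have hK₀le : ((K₀ : ℕ) : ℝ) ≤ (Ztop - H) / δ + 2 := by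
    rw [hK₀]; push_cast; have := Nat.ceil_lt_add_one hZH; linarith
  have hex : ∀ i ∈ T, ∃ k : ℕ, Ztop < ht (site i k) := by
    intro i hi
    refine ⟨K₀, lt_of_lt_of_le ?_ (hgrow i K₀)⟩
    have h1 := hlow i hi
    have h2 : Ztop - H < (K₀ : ℝ) * δ := by
      rw [div_lt_iff₀ hδ0] at hK₀gt; linarith
    show Ztop < ht (bp (mi i) (ai i) (bi i)) + K₀ * δ
    simp only [hht] at h1 ⊢; linarith
  set n : ι → ℕ := fun i => if hi : i ∈ T then Nat.find (hex i hi) else 0 with hn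
  have hn_spec : ∀ i (hi : i ∈ T), Ztop < ht (site i (n i)) := by
    intro i hi; simp only [hn, dif_pos hi]; exact Nat.find_spec (hex i hi)
  have hn_min : ∀ i (hi : i ∈ T), ∀ k < n i, ht (site i k) ≤ Ztop := by
    intro i hi k hk
    simp only [hn, dif_pos hi] at hk
    have := Nat.find_min (hex i hi) hk
    push Not at this; exact this
  have hn_le : ∀ i (hi : i ∈ T), n i ≤ K₀ := by
    intro i hi; simp only [hn, dif_pos hi]
    exact Nat.find_le (by
      refine lt_of_lt_of_le ?_ (hgrow i K₀)
      have h1 := hlow i hi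
      have h2 : Ztop - H < (K₀ : ℝ) * δ := by rw [div_lt_iff₀ hδ0] at hK₀gt; linarith
      show Ztop < ht (bp (mi i) (ai i) (bi i)) + K₀ * δ
      simp only [hht] at h1 ⊢; linarith)
  have hin : ∀ i ∈ T, ∀ k < n i, site i k ∈ R := by
    intro i hi k hk
    obtain ⟨a, b, hab⟩ := site_mem_barlowLayer σ L z v₀ ms hσ hv₀ hv₀2 hms₁ hms₂ (mi i) (ai i) (bi i) k
    have hab' : site i k = bp (mi i + k) a b := hab
    have f1 : H ≤ ht (site i k) := by
      have h1 := hgrow i k; have h2 := hlow i hi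
      have h3 : (0 : ℝ) ≤ k * δ := by positivity
      simp only [hht, hsite, hbp] at h1 h2 ⊢; linarith
    have f2 : ht (site i k) ≤ Ztop := hn_min i hi k hk
    have f3 : ‖site i k - bp (mi i) (ai i) (bi i)‖ ≤ (Ztop - H) / δ + 1 := by
      have hd : site i k - bp (mi i) (ai i) (bi i) = ∑ k' ∈ Finset.range k, ms (mi i + k') := by simp only [hsite]; abel
      rw [hd]
      calc ‖∑ k' ∈ Finset.range k, ms (mi i + k')‖ ≤ ∑ k' ∈ Finset.range k, ‖ms (mi i + k')‖ := norm_sum_le _ _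
        _ = k := by simp [hms]
        _ ≤ (Ztop - H) / δ + 1 := by
            have hk' : (k : ℝ) + 1 ≤ (n i : ℕ) := by exact_mod_cast hk
            have hni : ((n i : ℕ) : ℝ) ≤ K₀ := by exact_mod_cast hn_le i hi
            linarith
    rw [hab'] at f1 f2 f3 ⊢
    exact hRin i hi (mi i + k) a b f1 f2 f3
  have hexit : ∀ i ∈ T, ∀ j ∈ T, ht (bp (mi j) (ai j) (bi j)) < ht (site i (n i)) := by
    intro i hi j hj
    have h1 := hn_spec i hi
    have h2 : ht (bp (mi j) (ai j) (bi j)) < H + 1 := by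
      have h3 := hpred j hj
      have h4 := height_step_le L s₀ e ms he hms (bp (mi j) (ai j) (bi j) - ms (mi j - 1)) (mi j - 1)
      rw [sub_add_cancel] at h4
      simp only [hht]; linarith
    linarith
  have hlines : ∀ i ∈ T, ∀ j ∈ T, i ≠ j → ∀ k ≤ n i, site i k ≠ bp (mi j) (ai j) (bi j) := by
    intro i hi j hj hij k hk heq
    rcases Nat.eq_zero_or_pos k with hk0 | hkpos
    · subst hk0
      have : site i 0 = bp (mi i) (ai i) (bi i) := by simp [hsite]
      rw [this] at heq
      exact hij (hinjT i hi j hj heq)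
    · obtain ⟨k₁, rfl⟩ := Nat.exists_eq_add_of_lt hkpos
      simp only [zero_add] at heq hk
      obtain ⟨a, b, hab⟩ := site_mem_barlowLayer σ L z v₀ ms hσ hv₀ hv₀2 hms₁ hms₂ (mi i) (ai i) (bi i) (k₁ + 1)
      have hab' : site i (k₁ + 1) = bp (mi i + ((k₁ + 1 : ℕ) : ℤ)) a b := hab
      have hlayer : mi i + ((k₁ + 1 : ℕ) : ℤ) = mi j := by
        rw [hab'] at heq
        exact (barlowPos_injective σ heq).1
      have hpredeq : bp (mi j) (ai j) (bi j) - ms (mi j - 1) = site i k₁ := by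
        rw [← heq, hsucc, ← hlayer]
        have e' : mi i + ((k₁ + 1 : ℕ) : ℤ) - 1 = mi i + (k₁ : ℤ) := by push_cast; ring
        rw [e', add_sub_cancel_right]
      have h1 := hpred j hj
      rw [hpredeq] at h1
      have h2 := hgrow i k₁; have h3 := hlow i hi
      have h4 : (0 : ℝ) ≤ k₁ * δ := by positivity
      simp only [hht] at h1 h2 h3
      linarith
  exact canon_walkRun_injOn_tiltRef σ L s₀ z v₀ canon ms hσ hX₁ hs₁ hcert hz hze hv₀ hv₀2 hcanon₁ hcanon₂ hms₁ hms₂ R hR T mi ai bi n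
    hin hvalid hlines hexit N

end Moved

end Summit.Ventures.Crystal3D.Theorems

end
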